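import Literature.AlgebraicGeometry.Frobenioids.MotivatingExamplesEx63NonGalois
import Literature.AlgebraicGeometry.Frobenioids.MotivatingExamplesSubHoldsB
import HarnessLib

/-!
# Frobenioids I, §6 sub-DAG, row E63/L05 `Ex63_hypotheses` (the hypotheses of Thm. 5.2 for the data of
# Example 6.3): the universal closure AS TYPED (no `F̃/F` Galois) is FALSE

Mochizuki, *The geometry of Frobenioids I: the general theory*, Kyushu J. Math. **62** (2008) 293–400,
Example 6.3, kurims text p. 113 l. 4–21: "Let `F` be a number field, `F̃` a Galois extension of `F` … `Φ`, `B`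
determine monoids on `D` … Thus, by Theorem 5.2, (ii), this data determines a [model] Frobenioid `C_{F̃/F}`"
[cite: MochizukiFrdI2008, Ex. 6.3 p.113].

PROOF-ONLY companion (cell abc-iut, block F fact-proving wave, seat abc-iut-f-043; FACT-LIST row F-1129
`Ex63_hypotheses` of `plan/FACT-LIST.md`, `kernel_closedness = parametrised`, R7-demoted to "proved at named
instance families only"). No definitions, nothing re-typed; the declaring file `MotivatingExamplesSub.lean` is
imported (through abc-iut-f-013's `MotivatingExamplesEx63NonGalois.lean`), never edited.

WHAT THE KERNEL RECORDS. `Ex63_hypotheses F K := ModelFrobenioid.Hypotheses (arithDivisorFunctor F K)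
(unitsFunctor F K)` is typed over `(F) [Field F] [NumberField F] (K) [Field K] [Algebra F K]` — the print's "`F̃/F`
Galois" is not among the binders. The trunk composition `Ex63_isFrobenioid_of_hypotheses` (Thm. 5.2 (ii)) turns
the hypotheses into row E63/L06 `Ex63_isFrobenioid F K`, whose universal closure abc-iut-f-013 REFUTED at the rigid
cubic field `ℚ(∛2)/ℚ` (`not_forall_ex63_isFrobenioid`, `Ex63NonGalois.not_ex63_isFrobenioid_cubicField`: the
FSM-morphism `Spec ℚ(∛2) → Spec ℚ` does not pull the arithmetic divisor monoid back bijectively, Def. 1.1 (ii)).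
Hence the universal closure of E63/L05 is false too (`not_Ex63_hypotheses_cubicField`,
`not_forall_Ex63_hypotheses`); the printed instance form (`F̃/F` Galois) is abc-iut-L6-t10's landed
`Ex63_hypotheses_holds` (`MotivatingExamplesSubHoldsB.lean`, cited not restated). So F-1129 is: universal closure
REFUTED; instance form PROVED — an R5 schema row; consumers keep `[IsGalois F K]`. Nothing here bears on
[IUTchIII] Cor. 3.12 or asserts anything about abc.
-/

noncomputable section

namespace Literature.AlgebraicGeometry.Frobenioids

open Polynomial

/-- **E63/L05 fails at `ℚ ⊂ ℚ(∛2)`** (not Galois): the hypotheses of Thm. 5.2 would make `C_{ℚ(∛2)/ℚ}` a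
Frobenioid (`Ex63_isFrobenioid_of_hypotheses`), which abc-iut-f-013 refuted
(`Ex63NonGalois.not_ex63_isFrobenioid_cubicField`). [cite: MochizukiFrdI2008, Ex. 6.3 p.113] -/
theorem not_Ex63_hypotheses_cubicField [Fact (Irreducible (X ^ 3 - C 2 : ℚ[X]))] :
    ¬ Ex63_hypotheses ℚ (AdjoinRoot (X ^ 3 - C 2 : ℚ[X])) := fun h =>
  Ex63NonGalois.not_ex63_isFrobenioid_cubicField (Ex63_isFrobenioid_of_hypotheses _ _ h)

/-- **F-1129, universal closure AS TYPED (no Galois hypothesis) is false** — witness `F = ℚ`, `K = ℚ(∛2)`;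
the printed instance form (`F̃/F` Galois) is `Ex63_hypotheses_holds`. [cite: MochizukiFrdI2008, Ex. 6.3 p.113] -/
theorem not_forall_Ex63_hypotheses :
    ¬ ∀ (F : Type) [Field F] [NumberField F] (K : Type) [Field K] [Algebra F K], Ex63_hypotheses F K :=
  fun h => not_forall_ex63_isFrobenioid fun F _ _ K _ _ => Ex63_isFrobenioid_of_hypotheses F K (h F K)

/-- The two faces of F-1129 side by side: refuted over its own binders, PROVED under the printed hypothesis
(`[IsGalois F K]`, abc-iut-L6-t10's `Ex63_hypotheses_holds`). [cite: MochizukiFrdI2008, Ex. 6.3 p.113] -/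
theorem Ex63_hypotheses_iff_true_of_isGalois (F : Type) [Field F] [NumberField F] (K : Type) [Field K]
    [Algebra F K] [IsGalois F K] : Ex63_hypotheses F K ↔ True :=
  iff_true_intro (Ex63_hypotheses_holds F K)

end Literature.AlgebraicGeometry.Frobenioids

end
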